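import Summits.BirchSwinnertonDyer.Rank1Residual.P2.CongruentNumberSilentEvenFiveOddIndexDatum
import Summits.BirchSwinnertonDyer.Rank1Residual.P2.CongruentNumberSilentEvenFiveSelmerEight
import HarnessLib

/-!
# Cell `bsd-monsky`: the odd-index Heegner datum + Monsky's EVEN formula ⟹ C-P2-1 on `𝒮⁻`
# — the tier-0 glue of `CongruentNumberSilentEvenFiveOddIndexDatum.lean` with the displayed fact
# `h515` (Monsky 1990 Cor 5.15) replaced by `hMe` (Heath-Brown 1994 appendix) (nothing asserted)

HONEST FRAMING (cell `bsd-monsky`, run/shared/lean/pub/bsd-monsky/, README §1: ONE theorem on ONE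
explicit infinite family of quadratic twists of the congruent number curve at the prime `2`; not
"BSD for rank ≤ 1", nothing at odd primes, nothing booked until the cross-family referee passes the
written proof). This file asserts NO arithmetic fact: every theorem takes the datum
`P2.OddIndexHeegnerDatum (2pq)` on `𝒮⁻` as an explicit HYPOTHESIS (`hmech`, the output of the Monsky
route — never a fact) together with `hMe : HeathBrown1994.monsky_card_selmerGroup_two_even`, and
reproduces the §2 glue of the tier-0 module with that pair in place of `{h515, hmech}`:

* §1 Monsky's Cor 5.15 (2′) with Remark (2) ON `𝒮⁻` IS A THEOREM modulo `hMe` and the datum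
  (`cor515_two_mul_five_mul_of_monskyEven_of_oddIndexHeegnerDatum`): `#Sel₂ = 8` is the kernel-counted
  even Monsky matrix (`SelmerEight.lean` §1), rank `1` is `≤ 1` from the descent count and `≥ 1` from the
  datum's (M-y) clause (`SelmerEight.lean` §2), `Ш[2^∞] = 0` from both;
* §2 the datum ⟹ `𝓛(2pq)` odd ⟹ `CongruentSilentEvenFiveOrdTwo` (the proof of
  `congruentSilentEvenFiveOrdTwo_of_oddIndexHeegnerDatum` verbatim, its one use of `h515` replaced by §1),
  and ⟹ `CongruentSilentEvenFiveBSDTwo` through the fact-free door.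

Consequently C-P2-1 is a tree theorem relative to `{hMe, hmech}`, and — once the typer's enclosure
`P2/CongruentNumberSilentEvenFiveEnclosure(Genus).lean` is in the tree (`oddIndexHeegnerDatum_of_system`)
— relative to `{hMe, hSys}` with no Monsky 1990 binder at all. This is the logical shape of the written
proof of record (HOME/proof/PROOF-A.md v3.4: §7 explicit `2`-descent + the Heegner point give rank one
and `#Sel₂ = 8`; Cor 5.15 is never used). Nothing asserted; the conjecture `Prop`s stay `@[conjecture]`.

References: [HeathBrown1994SelmerCongruentII] §1 (typescript p. 1 L14–L20), Appendix (Monsky) p. 41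
L20–L36; [Monsky1990MockHeegner] Lemma 3.3 (3) and Remark (p. 53) (the odd-index argument), Cor. 5.15 (p. 66)
and Remark (2) (p. 67) (the fact replaced here); [SilvermanAEC2009] Thm. X.4.2, Thm. VIII.6.7;
[TianYuanZhang2017] §1 (𝓛(n), (1.1)); [Miller2011LMS] Def. 1.1.
-/

noncomputable section

open scoped Classical

open WeierstrassCurve Literature.NumberTheory.EllipticCurves
  Literature.NumberTheory.EllipticCurves.Rank1Residual
  Literature.NumberTheory.EllipticCurves.Rank1Residual.Typed
  Literature.NumberTheory.EllipticCurves.HeathBrown1994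
  Literature.NumberTheory.EllipticCurves.Monsky1990
  Literature.NumberTheory.EllipticCurves.TianYuanZhang2017

set_option autoImplicit false

namespace Summit.BirchSwinnertonDyer.Rank1Residual.P2

open Conjectures

section Datum

variable [inst : DecidableEq ℚ]

/-! ## §1 Cor 5.15 (2′) + Remark (2) on `𝒮⁻` as a theorem modulo `hMe` and the datum -/

/-- **Rank `E_{2pq}(ℚ) = 1` on `𝒮⁻` from `hMe` and the datum**: `#Sel₂ = 8` (kernel-counted even Monsky
matrix) bounds the rank by `1`; the datum's point `y ∉ 2E(ℚ) + E(ℚ)_tor` forces rank `≥ 1`.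
[cite: HeathBrown1994SelmerCongruentII, Appendix (Monsky), typescript p. 41 L20–L36]
[cite: SilvermanAEC2009, Thm. X.4.2, Thm. VIII.6.7] -/
theorem mordellWeilRank_eq_one_of_oddIndexHeegnerDatum_of_monskyEven
    (hMe : monsky_card_selmerGroup_two_even) {p q : ℕ} (hp : p.Prime) (hq : q.Prime)
    (hp5 : p % 8 = 5) (hq4 : q % 4 = 3) (hj : jacobiSym p q = -1)
    (h : OddIndexHeegnerDatum (2 * (p * q))) :
    (congruentNumberCurve (2 * (p * q))).mordellWeilRank = 1 := by
  obtain ⟨hN, -, -, -⟩ := isCor515Family_two_mul_five_mul hp hq hp5 hq4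
  obtain ⟨y, L, -, -, hy⟩ := h
  exact mordellWeilRank_eq_one_of_card_selmerGroup_two_eq_eight hN.ne_zero
    (card_selmerGroup_two_two_mul_five_mul hMe hp hq hp5 hq4 hj) y hy

/-- **Monsky 1990 Cor 5.15 (2′) with Remark (2), restricted to `𝒮⁻`, is a THEOREM** modulo Monsky's
even matrix formula (`hMe`) and the datum: rank `1`, `#Sel₂(E_{2pq}) = 8`, `Ш(E_{2pq})[2^∞] = 0`.
The displayed fact `cor515_rank_eq_one_and_card_selmerGroup_two` is not used.
[cite: HeathBrown1994SelmerCongruentII, §1 (typescript p. 1 L14–L20), Appendix (Monsky) p. 41 L20–L36]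
[cite: SilvermanAEC2009, Thm. X.4.2] [cite: Monsky1990MockHeegner, Cor. 5.15 (2′) (p. 66), Remark (2) (p. 67)] -/
theorem cor515_two_mul_five_mul_of_monskyEven_of_oddIndexHeegnerDatum
    (hMe : monsky_card_selmerGroup_two_even)
    (hmech : ∀ p q : ℕ, p.Prime → q.Prime → p % 8 = 5 → q % 4 = 3 → jacobiSym p q = -1 →
      OddIndexHeegnerDatum (2 * (p * q))) :
    ∀ p q : ℕ, p.Prime → q.Prime → p % 8 = 5 → q % 4 = 3 → jacobiSym p q = -1 →
      (congruentNumberCurve (2 * (p * q))).mordellWeilRank = 1 ∧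
        Nat.card ((congruentNumberCurve (2 * (p * q))).selmerGroup 2) = 8 ∧
        AddCommGroup.primaryComponent (congruentNumberCurve (2 * (p * q))).sha 2 = ⊥ := by
  intro p q hp hq hp5 hq4 hj
  obtain ⟨hN, -, -, -⟩ := isCor515Family_two_mul_five_mul hp hq hp5 hq4
  have hrank := mordellWeilRank_eq_one_of_oddIndexHeegnerDatum_of_monskyEven hMe hp hq hp5 hq4 hj
    (hmech p q hp hq hp5 hq4 hj)
  have hsel := card_selmerGroup_two_two_mul_five_mul hMe hp hq hp5 hq4 hj
  exact ⟨hrank, hsel, primaryComponent_sha_two_eq_bot_of_card_selmerGroup_eq_eight hN.ne_zero hrank hsel⟩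

/-! ## §2 Glue: the datum ⟹ C-P2-1, with `hMe` in place of `h515` -/

/-- **C-P2-1, SHARPER (`Ш_an`-unit) FORM, from the datum on `𝒮⁻` and Monsky's even formula** (no
Cor 5.15): the proof of `congruentSilentEvenFiveOrdTwo_of_oddIndexHeegnerDatum` verbatim, rank one now
from §1. For every `(p, q)` of `𝒮⁻`: `𝓛(2pq)` odd (`exists_odd_scriptL_of_oddIndexHeegnerDatum`),
`ord_{s=1} L = 1` (root number `−1`, `𝓛 ≠ 0`), `L′(E_{2pq}, 1) = 2²·𝓛²·Ω·Reg`, so `x = 4𝓛²` has `ord₂ x = 2`.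
[cite: TianYuanZhang2017, §1 (definition of 𝓛(n) and (1.1), p0002 L46–L75)]
[cite: Monsky1990MockHeegner, Lemma 3.3 (3) and the Remark after it (p. 53)]
[cite: HeathBrown1994SelmerCongruentII, Appendix (Monsky), typescript p. 41 L20–L36] -/
theorem congruentSilentEvenFiveOrdTwo_of_oddIndexHeegnerDatum_of_monskyEven
    (hMe : monsky_card_selmerGroup_two_even)
    (hmech : ∀ p q : ℕ, p.Prime → q.Prime → p % 8 = 5 → q % 4 = 3 → jacobiSym p q = -1 →
      OddIndexHeegnerDatum (2 * (p * q))) :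
    CongruentSilentEvenFiveOrdTwo := by
  intro p q hp hq hp5 hq4 hj
  obtain ⟨hN, hp2, hq2, hne⟩ := isCor515Family_two_mul_five_mul hp hq hp5 hq4
  have hsq : Squarefree (2 * (p * q)) := hN.squarefree
  haveI := isElliptic_congruentNumberCurve hN.ne_zero
  have hrank : (congruentNumberCurve (2 * (p * q))).mordellWeilRank = 1 :=
    mordellWeilRank_eq_one_of_oddIndexHeegnerDatum_of_monskyEven hMe hp hq hp5 hq4 hj
      (hmech p q hp hq hp5 hq4 hj)
  obtain ⟨L, hLodd, hL⟩ :=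
    exists_odd_scriptL_of_oddIndexHeegnerDatum hN.ne_zero hrank (hmech p q hp hq hp5 hq4 hj)
  have hL0' : L ≠ 0 := fun h => by simp [h] at hLodd
  have hL0 : (L : ℚ) ≠ 0 := by exact_mod_cast hL0'
  have hr1 := analyticRank_congruentNumberCurve_eq_one_of_isScriptL hsq hN.mod_eight hL hL0'
  obtain ⟨he, -⟩ := twoExponent_tamagawa_two_mul_prime_mul hp hq hp2 hq2 hne
  refine ⟨(2 : ℚ) ^ twoExponent (2 * (p * q)) * (L : ℚ) ^ 2,
    mul_ne_zero (zpow_ne_zero _ two_ne_zero) (pow_ne_zero _ hL0), ?_, ?_⟩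
  · rw [← (leadingLCoeff_eq_deriv_of_analyticRank_eq_one hr1).1,
      leadingLCoeff_congruentNumberCurve_eq_of_isScriptL (Nat.pos_of_ne_zero hN.ne_zero) hr1 hL]
    push_cast
    ring
  · rw [padicValRat_two_zpow_mul_sq hLodd, he]

/-- **C-P2-1, OBSERVABLE FORM (`ord_{s=1} L(E_{2pq}, s) = 1 ∧ BSD(E_{2pq}, 2)` on all of `𝒮⁻`), from the
datum and Monsky's even formula** — the fact-free door of `SelmerEight.lean` §4 with rank one per
member from §1. CONDITIONAL on `hmech` (the Monsky route's output) and on `hMe`; no Monsky 1990 binder;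
nothing asserted. [cite: HeathBrown1994SelmerCongruentII, Appendix (Monsky), typescript p. 41 L20–L36]
[cite: Miller2011LMS, Def. 1.1 (arXiv:1010.2431 p. 3)] -/
theorem congruentSilentEvenFiveBSDTwo_of_oddIndexHeegnerDatum_of_monskyEven
    (hMe : monsky_card_selmerGroup_two_even)
    (hmech : ∀ p q : ℕ, p.Prime → q.Prime → p % 8 = 5 → q % 4 = 3 → jacobiSym p q = -1 →
      OddIndexHeegnerDatum (2 * (p * q))) :
    CongruentSilentEvenFiveBSDTwo :=
  congruentSilentEvenFiveBSDTwo_of_ordTwo_of_monskyEven hMe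
    (fun p q hp hq hp5 hq4 hj =>
      mordellWeilRank_eq_one_of_oddIndexHeegnerDatum_of_monskyEven hMe hp hq hp5 hq4 hj
        (hmech p q hp hq hp5 hq4 hj))
    (congruentSilentEvenFiveOrdTwo_of_oddIndexHeegnerDatum_of_monskyEven hMe hmech)

/-! ## §3 (append, g5) The same glue with the written proof's Selmer bound `#Sel₂ ≤ 8` in place of `hMe` -/

/-- **Cor 5.15 (2′) + Remark (2) on `𝒮⁻` from the written proof's Selmer bound and the datum**: with
`hD : #Sel₂(E_{2pq}) ≤ 8` (PROOF-A Lemma 7.1 (a), App. D; an in-house input like `hA`) instead of `hMe`,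
rank `1`, `#Sel₂ = 8` and `Ш[2^∞] = 0` follow from the datum's point (`rank_eq_one_card_selmerGroup_two_eq_eight_sha_of_le_eight`).
[cite: SilvermanAEC2009, Thm. X.4.2, Thm. VIII.6.7] [cite: Monsky1990MockHeegner, Cor. 5.15 (2′) (p. 66), Remark (2) (p. 67)] -/
theorem cor515_two_mul_five_mul_of_selmer_le_eight_of_oddIndexHeegnerDatum
    (hD : ∀ p q : ℕ, p.Prime → q.Prime → p % 8 = 5 → q % 4 = 3 → jacobiSym p q = -1 →
      Nat.card ((congruentNumberCurve (2 * (p * q))).selmerGroup 2) ≤ 8)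
    (hmech : ∀ p q : ℕ, p.Prime → q.Prime → p % 8 = 5 → q % 4 = 3 → jacobiSym p q = -1 →
      OddIndexHeegnerDatum (2 * (p * q))) :
    ∀ p q : ℕ, p.Prime → q.Prime → p % 8 = 5 → q % 4 = 3 → jacobiSym p q = -1 →
      (congruentNumberCurve (2 * (p * q))).mordellWeilRank = 1 ∧
        Nat.card ((congruentNumberCurve (2 * (p * q))).selmerGroup 2) = 8 ∧
        AddCommGroup.primaryComponent (congruentNumberCurve (2 * (p * q))).sha 2 = ⊥ := by
  intro p q hp hq hp5 hq4 hj
  obtain ⟨hN, -, -, -⟩ := isCor515Family_two_mul_five_mul hp hq hp5 hq4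
  obtain ⟨y, L, -, -, hy⟩ := hmech p q hp hq hp5 hq4 hj
  exact rank_eq_one_card_selmerGroup_two_eq_eight_sha_of_le_eight hN.ne_zero (hD p q hp hq hp5 hq4 hj) y hy

/-- **C-P2-1, SHARPER FORM, from the datum and the written proof's Selmer bound** (no named fact): as
`congruentSilentEvenFiveOrdTwo_of_oddIndexHeegnerDatum_of_monskyEven`, rank one now from §3.
[cite: TianYuanZhang2017, §1 (definition of 𝓛(n) and (1.1), p0002 L46–L75)]
[cite: Monsky1990MockHeegner, Lemma 3.3 (3) and the Remark after it (p. 53)] [cite: SilvermanAEC2009, Thm. X.4.2] -/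
theorem congruentSilentEvenFiveOrdTwo_of_oddIndexHeegnerDatum_of_selmer_le_eight
    (hD : ∀ p q : ℕ, p.Prime → q.Prime → p % 8 = 5 → q % 4 = 3 → jacobiSym p q = -1 →
      Nat.card ((congruentNumberCurve (2 * (p * q))).selmerGroup 2) ≤ 8)
    (hmech : ∀ p q : ℕ, p.Prime → q.Prime → p % 8 = 5 → q % 4 = 3 → jacobiSym p q = -1 →
      OddIndexHeegnerDatum (2 * (p * q))) :
    CongruentSilentEvenFiveOrdTwo := by
  intro p q hp hq hp5 hq4 hj
  obtain ⟨hN, hp2, hq2, hne⟩ := isCor515Family_two_mul_five_mul hp hq hp5 hq4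
  have hsq : Squarefree (2 * (p * q)) := hN.squarefree
  haveI := isElliptic_congruentNumberCurve hN.ne_zero
  have hrank : (congruentNumberCurve (2 * (p * q))).mordellWeilRank = 1 :=
    (cor515_two_mul_five_mul_of_selmer_le_eight_of_oddIndexHeegnerDatum hD hmech p q hp hq hp5 hq4 hj).1
  obtain ⟨L, hLodd, hL⟩ :=
    exists_odd_scriptL_of_oddIndexHeegnerDatum hN.ne_zero hrank (hmech p q hp hq hp5 hq4 hj)
  have hL0' : L ≠ 0 := fun h => by simp [h] at hLodd
  have hL0 : (L : ℚ) ≠ 0 := by exact_mod_cast hL0'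
  have hr1 := analyticRank_congruentNumberCurve_eq_one_of_isScriptL hsq hN.mod_eight hL hL0'
  obtain ⟨he, -⟩ := twoExponent_tamagawa_two_mul_prime_mul hp hq hp2 hq2 hne
  refine ⟨(2 : ℚ) ^ twoExponent (2 * (p * q)) * (L : ℚ) ^ 2,
    mul_ne_zero (zpow_ne_zero _ two_ne_zero) (pow_ne_zero _ hL0), ?_, ?_⟩
  · rw [← (leadingLCoeff_eq_deriv_of_analyticRank_eq_one hr1).1,
      leadingLCoeff_congruentNumberCurve_eq_of_isScriptL (Nat.pos_of_ne_zero hN.ne_zero) hr1 hL]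
    push_cast
    ring
  · rw [padicValRat_two_zpow_mul_sq hLodd, he]

/-- **C-P2-1, OBSERVABLE FORM, from the datum and the written proof's Selmer bound** — rank `1`,
`#Sel₂ = 8`, `Ш[2^∞] = 0` from §3, the fact-free door of `SelmerEight.lean` §3, `∏c_ℓ = 2⁶`. CONDITIONAL on
`hmech` and `hD` (both in-house inputs of the written proof of record); no named fact; nothing asserted.
[cite: SilvermanAEC2009, Thm. X.4.2] [cite: Miller2011LMS, Def. 1.1 (arXiv:1010.2431 p. 3)] -/
theorem congruentSilentEvenFiveBSDTwo_of_oddIndexHeegnerDatum_of_selmer_le_eight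
    (hD : ∀ p q : ℕ, p.Prime → q.Prime → p % 8 = 5 → q % 4 = 3 → jacobiSym p q = -1 →
      Nat.card ((congruentNumberCurve (2 * (p * q))).selmerGroup 2) ≤ 8)
    (hmech : ∀ p q : ℕ, p.Prime → q.Prime → p % 8 = 5 → q % 4 = 3 → jacobiSym p q = -1 →
      OddIndexHeegnerDatum (2 * (p * q))) :
    CongruentSilentEvenFiveBSDTwo := by
  intro p q hp hq hp5 hq4 hj
  obtain ⟨hN, hp2, hq2, hne⟩ := isCor515Family_two_mul_five_mul hp hq hp5 hq4
  haveI := isElliptic_congruentNumberCurve hN.ne_zero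
  haveI : Fact (Nat.Prime 2) := ⟨Nat.prime_two⟩
  obtain ⟨x, hx0, hx, hv⟩ :=
    congruentSilentEvenFiveOrdTwo_of_oddIndexHeegnerDatum_of_selmer_le_eight hD hmech p q hp hq hp5 hq4 hj
  obtain ⟨-, htam⟩ := twoExponent_tamagawa_two_mul_prime_mul hp hq hp2 hq2 hne
  obtain ⟨hr, -, hbot⟩ :=
    cor515_two_mul_five_mul_of_selmer_le_eight_of_oddIndexHeegnerDatum hD hmech p q hp hq hp5 hq4 hj
  obtain ⟨hr1, hiff⟩ := bsdp_two_congruentNumberCurve_iff_of_rank_one_of_sha_two_eq_bot hN hr hbot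
    (torsionOrder_congruentNumberCurve hN.squarefree) hx0 hx
  refine ⟨hr1, hiff.mpr ?_⟩
  rw [hv, htam, padicValNat.prime_pow]
  norm_num

end Datum

end Summit.BirchSwinnertonDyer.Rank1Residual.P2

end
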